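import Mathlib
import Summits.CriticalPhenomena.Ising3DConformalLimit.Theses.GaussianScaleMixture
import Summits.CriticalPhenomena.Ising3DConformalLimit.Theorems.GaussianScaleMixtureCriticalTwoPointGSMExistsExchangeableRepOfRep
import Summits.CriticalPhenomena.Ising3DConformalLimit.Theorems.GaussianScaleMixtureCriticalTwoPointGSMCubeRepOfApproximants
import Summits.CriticalPhenomena.Ising3DConformalLimit.Theorems.GaussianScaleMixtureCriticalTwoPointGSMCriticalTwoPointGSMOfCubeRepNoFace

/-!
# Exchangeability is free for cube representations of the critical two-point function

Line `Sketch` of the crux `CriticalTwoPointGSM` (stmt-CriticalPhenomena-8365), interface stub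
`exchangeableCubeRep_of_cubeRep` (seat -1). A CUBE REPRESENTATION of `G = criticalTwoPoint 3` is a
probability measure `μ` on `ℝ³` carried by the closed cube `[0,1]³` with `G x = ∫ ∏ᵢ tᵢ^{xᵢ²} dμ(t)`
(closed Gaussian-scale-mixture cone, faces `tᵢ = 0` allowed). This file shows that such a `μ` may
always be taken EXCHANGEABLE (invariant under the coordinate permutations), by the `S₃`-average of
its push-forwards — the cube analogue of `Theorems.exists_exchangeable_rep_of_rep` (p88466), whose
generic symmetrisation lemmas (`CriticalTwoPointGSMSymm.symmAverage_apply`,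
`isProbabilityMeasure_symmAverage`, `symmAverage_exchangeable`) and
`CriticalTwoPointGSMNoFace.continuous_polyKernel` (p98640) are reused verbatim; only the
invariance of the off-cube defect set and of the POLYNOMIAL kernel under permutations is new here.
It connects the recommended closed-cone re-typing of the crux (with its exchangeability clause) to
the tightness-free transfer `subcriticalGSM ⟹ cube representation` of the line.
-/

namespace Summit.CriticalPhenomena.Ising3DConformalLimit.Theorems

open MeasureTheory Filter Topology
open Literature.Probability.LatticeModels
open scoped BigOperators

namespace CriticalTwoPointGSMCubeSymm

open CriticalTwoPointGSMSymm
open CriticalTwoPointGSMNoFace (continuous_polyKernel)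

/-- The off-cube defect set `{t | ∃ i, tᵢ < 0 ∨ 1 < tᵢ}` is invariant under coordinate
permutations. -/
theorem preimage_compPerm_offCube (σ : Equiv.Perm (Fin 3)) :
    (fun t : Fin 3 → ℝ => t ∘ σ) ⁻¹' {t | ∃ i, t i < 0 ∨ 1 < t i} = {t | ∃ i, t i < 0 ∨ 1 < t i} := by
  ext t
  simp only [Set.mem_preimage, Set.mem_setOf_eq, Function.comp_apply]
  constructor
  · rintro ⟨i, hi⟩; exact ⟨σ i, hi⟩
  · rintro ⟨i, hi⟩; exact ⟨σ.symm i, by simpa using hi⟩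

/-- The off-cube defect set is measurable. -/
theorem measurableSet_offCube : MeasurableSet {t : Fin 3 → ℝ | ∃ i, t i < 0 ∨ 1 < t i} :=
  CriticalTwoPointGSMCube.isOpen_offCube.measurableSet

/-- Permuting the coordinates of `t` in the polynomial kernel amounts to permuting the lattice point:
`∏ᵢ (t (σ i))^{|xᵢ|²} = ∏ⱼ tⱼ^{|x (σ⁻¹ j)|²}`. -/
theorem polyKernel_compPerm (x : Site 3) (σ : Equiv.Perm (Fin 3)) (t : Fin 3 → ℝ) :
    ∏ i, ((t ∘ σ) i) ^ ((x i).natAbs ^ 2) = ∏ j, (t j) ^ (((fun j => x (σ.symm j)) j).natAbs ^ 2) := by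
  simp only [Function.comp_apply]
  exact Fintype.prod_equiv σ (fun i => t (σ i) ^ ((x i).natAbs ^ 2))
    (fun j => t j ^ ((x (σ.symm j)).natAbs ^ 2)) fun i => by simp

/-- A cube representation of the critical two-point function is again one after pushing the
measure forward along a coordinate permutation (lattice symmetry of `⟨σ₀σ_x⟩⁺_{β_c}`). -/
theorem cubeRep_map_compPerm {μ : Measure (Fin 3 → ℝ)}
    (hrep : ∀ x : Site 3, criticalTwoPoint 3 x = ∫ t, ∏ i, (t i) ^ ((x i).natAbs ^ 2) ∂μ)
    (σ : Equiv.Perm (Fin 3)) (x : Site 3) :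
    criticalTwoPoint 3 x =
      ∫ t, ∏ i, (t i) ^ ((x i).natAbs ^ 2) ∂(μ.map fun t : Fin 3 → ℝ => t ∘ σ) := by
  rw [integral_map (measurable_compPerm σ).aemeasurable (continuous_polyKernel x).aestronglyMeasurable]
  have hx : criticalTwoPoint 3 x = criticalTwoPoint 3 fun j => x (σ.symm j) :=
    (twoPointPlus_perm_invariant_holds (criticalBeta_nonneg 3) σ.symm x).symm
  rw [hx, hrep]
  refine integral_congr_ae (Filter.Eventually.of_forall fun t => ?_)
  exact (polyKernel_compPerm x σ t).symm

/-- The `S₃`-average of the push-forwards of a measure carried by the closed cube is carried by the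
closed cube. -/
theorem symmAverage_offCube {μ : Measure (Fin 3 → ℝ)} (hcube : μ {t | ∃ i, t i < 0 ∨ 1 < t i} = 0) :
    (((Fintype.card (Equiv.Perm (Fin 3)) : ENNReal)⁻¹) •
        ∑ σ : Equiv.Perm (Fin 3), μ.map fun s : Fin 3 → ℝ => s ∘ σ) {t | ∃ i, t i < 0 ∨ 1 < t i} = 0 := by
  rw [symmAverage_apply μ measurableSet_offCube]
  simp only [preimage_compPerm_offCube, hcube, Finset.sum_const_zero, mul_zero]

/-- The polynomial kernel is integrable against a finite measure carried by the closed cube. -/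
theorem integrable_polyKernel {μ : Measure (Fin 3 → ℝ)} [IsFiniteMeasure μ]
    (hcube : μ {t | ∃ i, t i < 0 ∨ 1 < t i} = 0) (x : Site 3) :
    Integrable (fun t : Fin 3 → ℝ => ∏ i, (t i) ^ ((x i).natAbs ^ 2)) μ := by
  refine Integrable.mono' (integrable_const (1 : ℝ)) (continuous_polyKernel x).aestronglyMeasurable ?_
  filter_upwards [CriticalTwoPointGSMCube.ae_mem_cube hcube] with t ht
  have h0 : ∀ i, 0 ≤ t i := fun i => (ht i).1
  rw [Real.norm_eq_abs, abs_of_nonneg (Finset.prod_nonneg fun i _ => pow_nonneg (h0 i) _)]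
  exact Finset.prod_le_one (fun i _ => pow_nonneg (h0 i) _) fun i _ => pow_le_one₀ (h0 i) (ht i).2

/-- The `S₃`-average of the push-forwards of a cube representation of the critical two-point
function again represents it. -/
theorem cubeRep_symmAverage {μ : Measure (Fin 3 → ℝ)} [IsProbabilityMeasure μ]
    (hcube : μ {t | ∃ i, t i < 0 ∨ 1 < t i} = 0)
    (hrep : ∀ x : Site 3, criticalTwoPoint 3 x = ∫ t, ∏ i, (t i) ^ ((x i).natAbs ^ 2) ∂μ)
    (x : Site 3) :
    criticalTwoPoint 3 x = ∫ t, ∏ i, (t i) ^ ((x i).natAbs ^ 2)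
      ∂(((Fintype.card (Equiv.Perm (Fin 3)) : ENNReal)⁻¹) •
        ∑ σ : Equiv.Perm (Fin 3), μ.map fun s : Fin 3 → ℝ => s ∘ σ) := by
  rw [integral_smul_measure, integral_finsetSum_measure]
  · have h : ∀ σ : Equiv.Perm (Fin 3),
        ∫ t, ∏ i, (t i) ^ ((x i).natAbs ^ 2) ∂(μ.map fun s : Fin 3 → ℝ => s ∘ σ) =
          criticalTwoPoint 3 x := fun σ => (cubeRep_map_compPerm hrep σ x).symm
    simp only [h, Finset.sum_const, Finset.card_univ, nsmul_eq_mul, ENNReal.toReal_inv,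
      ENNReal.toReal_natCast, smul_eq_mul]
    have hc : ((Fintype.card (Equiv.Perm (Fin 3)) : ℝ)) ≠ 0 := by exact_mod_cast Fintype.card_ne_zero
    field_simp
  · intro σ _
    haveI : IsProbabilityMeasure (μ.map fun s : Fin 3 → ℝ => s ∘ σ) :=
      Measure.isProbabilityMeasure_map (measurable_compPerm σ).aemeasurable
    have hcube' : (μ.map fun s : Fin 3 → ℝ => s ∘ σ) {t | ∃ i, t i < 0 ∨ 1 < t i} = 0 := by
      rw [Measure.map_apply (measurable_compPerm σ) measurableSet_offCube, preimage_compPerm_offCube,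
        hcube]
    exact integrable_polyKernel hcube' x

end CriticalTwoPointGSMCubeSymm

open CriticalTwoPointGSMSymm CriticalTwoPointGSMCubeSymm in
/-- **Exchangeability is free for cube representations.** If the critical two-point function
`criticalTwoPoint 3` has a cube representation (a probability measure on `ℝ³` carried by `[0,1]³`
with `G x = ∫ ∏ᵢ tᵢ^{xᵢ²} dμ`), then it has an EXCHANGEABLE one: the `S₃`-average of the
push-forwards of `μ` under the coordinate permutations (lattice symmetry of `⟨σ₀σ_x⟩⁺_{β_c}` makes
each push-forward a representation; the off-cube defect set is permutation invariant). -/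
theorem exchangeableCubeRep_of_cubeRep
    (h : ∃ μ : Measure (Fin 3 → ℝ), IsProbabilityMeasure μ ∧ μ {t | ∃ i, t i < 0 ∨ 1 < t i} = 0 ∧
      ∀ x : Site 3, criticalTwoPoint 3 x = ∫ t, ∏ i, (t i) ^ ((x i).natAbs ^ 2) ∂μ) :
    ∃ μ : Measure (Fin 3 → ℝ), IsProbabilityMeasure μ ∧ μ {t | ∃ i, t i < 0 ∨ 1 < t i} = 0 ∧
      (∀ σ : Equiv.Perm (Fin 3), μ.map (fun t : Fin 3 → ℝ => t ∘ σ) = μ) ∧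
      ∀ x : Site 3, criticalTwoPoint 3 x = ∫ t, ∏ i, (t i) ^ ((x i).natAbs ^ 2) ∂μ := by
  obtain ⟨μ, hP, hcube, hrep⟩ := h
  exact ⟨_, isProbabilityMeasure_symmAverage μ, symmAverage_offCube hcube,
    symmAverage_exchangeable μ, cubeRep_symmAverage hcube hrep⟩

end Summit.CriticalPhenomena.Ising3DConformalLimit.Theorems
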